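import Summits.SmoothPoincare4.SmoothPoincare4.Theorems.CongruenceShadowsAgkCor6SufficiencyFlowerCapDefs
import Summits.SmoothPoincare4.SmoothPoincare4.Theorems.CongruenceShadowsAgkCor6SufficiencyStubCapSeams
import HarnessLib

/-!
# Stub `stub_capArcs` of line `lp-by-sphere-system-surgery` for crux `AgkCor6Sufficiency`
(item stmt-SmoothPoincare4-10894, routes `CongruenceShadows` / `GroupTrisection`; lead reshape r6b)

**Arc-level basics of the capped melon.**  For the flower surface `Z_g` (`g = n + 2`) with the
polar cap `capU = {‖proj p‖ < 1/4, 0 < p 2}` removed, the truncated arcs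
`tArc hg k : Path (bot g) (capPt hg k)` (`tArc hg k t = Rk g k (vArcFun hg s)` with
`s = 2ρ₄ - t (2ρ₄ - 1/4) ∈ [1/4, 2ρ₄]`, i.e. the melon arc `arcK hg k` run from the lower pole up
to the cap circle) and the cap-circle arcs `capArc hg k` satisfy:

* `tArc hg k`, `tArc hg (k+1)` and `capArc hg k` lie in the capped slice `capS g k = secS g k ∖ capU`
  (the melon arcs lie in the slices, `FlowerModel.range_arcK_subset` /
  `FlowerModel.range_arcK_succ_subset`; a point `vArcFun hg s` with `s ≥ 1/4` has planar radius
  `s ≥ 1/4` on the upper sheet and height `≤ 0` on the lower sheet, so it is not in the cap; the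
  cap-circle arc is the upper sheet over `pol (1/4) θ`, `|θ| ≤ π/g`, which is in the wedge and has
  planar radius exactly `1/4`);
* `range (tArc hg k) = range (arcK hg k) ∖ capU` (a point of the arc of parameter `< 1/4` is an
  upper-sheet point of planar radius `< 1/4` and positive height `vHt`, i.e. in the cap:
  `range_arcK_diff_capU_subset_range_tArc` of the seams stub `StubCapSeams`);
* `tArc hg k` is injective (`FlowerModel.injOn_vArcFun` and the affine reparametrisation);
* `tArc hg (n+1)` and `tArc hg 0` meet only at the lower pole (`FlowerModel.arcK_meet`: the melon
  arcs meet only at the poles, and the upper pole is in the cap);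
* `range (tArc hg k)` and `range (tArc hg (n+1)) ∪ range (tArc hg 0)` are simply connected (an
  injective path of a Hausdorff space is an embedded interval; the union is the single injective
  path `(tArc hg (n+1))⁻¹ · tArc hg 0`).

References: Hatcher, *Algebraic Topology* (2002), §1.2 p. 51 [HatcherAT2002]. No `sorry`.
-/

set_option linter.dupNamespace false

noncomputable section

open Set Function Metric
open scoped Real unitInterval Topology

namespace Summit.SmoothPoincare4.SmoothPoincare4.Cruxes.AgkCor6Sufficiency.LpBySphereSystemSurgery

open Literature.Topology.FourManifolds Literature.Topology.FourManifolds.FlowerModel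
open PlanarThickening PlanarDouble

namespace FlowerCap

variable {g : ℕ}

/-! ## Helpers: the reparametrisation `s(t) = 2ρ₄ - t (2ρ₄ - 1/4)` -/

/-- The length `2ρ₄ - 1/4` of the parameter interval of the truncated arc is positive. -/
private theorem two_rho4_sub_capR_pos (hg : 2 ≤ g) : 0 < 2 * rho4 hg - capR := by
  have h1 := capR_le_rho4 hg
  have h2 := rho4_pos hg
  linarith

/-- The parameter `s(t)` is at least `1/4` for `t ∈ [0, 1]`. -/
private theorem capR_le_param (hg : 2 ≤ g) (t : I) : capR ≤ 2 * rho4 hg - t * (2 * rho4 hg - capR) := by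
  have h := two_rho4_sub_capR_pos hg
  have ht := t.2.2
  nlinarith

/-- The parameter `s(t)` lies in `[0, 2ρ₄]` for `t ∈ [0, 1]`. -/
private theorem param_mem_Icc (hg : 2 ≤ g) (t : I) :
    2 * rho4 hg - t * (2 * rho4 hg - capR) ∈ Icc 0 (2 * rho4 hg) := by
  have h := two_rho4_sub_capR_pos hg
  have ht := t.2.1
  exact ⟨capR_pos.le.trans (capR_le_param hg t), by nlinarith⟩

/-- `tArc hg k t` is the point of the melon arc `arcK hg k` of parameter `s(t) / (2ρ₄)`. -/
private theorem exists_tArc_eq_arcK (hg : 2 ≤ g) (k : ℕ) (t : I) :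
    ∃ u : I, tArc hg k t = arcK hg k u ∧
      2 * rho4 hg * (u : ℝ) = 2 * rho4 hg - t * (2 * rho4 hg - capR) := by
  have h4 : 0 < 2 * rho4 hg := by linarith [rho4_pos hg]
  obtain ⟨h0, h1⟩ := param_mem_Icc hg t
  refine ⟨⟨_ / (2 * rho4 hg), div_nonneg h0 h4.le, (div_le_one h4).2 h1⟩, ?_,
    mul_div_cancel₀ _ h4.ne'⟩
  rw [arcK_apply, vArc_apply, tArc_apply, tArcFun]
  dsimp only
  rw [mul_div_cancel₀ _ h4.ne']

/-! ## Helpers: the cap region -/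

/-- The rotations `Rk` preserve the planar radius. -/
private theorem norm_proj_Rk (k : ℕ) (p : EuclideanSpace ℝ (Fin 3)) :
    ‖proj (Rk g k p)‖ = ‖proj p‖ := by
  rw [Rk, proj_rot3, FlowerModel.norm_rot]

/-- The rotations `Rk` preserve the height. -/
private theorem Rk_apply_two (k : ℕ) (p : EuclideanSpace ℝ (Fin 3)) : Rk g k p 2 = p 2 := by
  rw [Rk, rot3_apply_two]

/-- The cap region is invariant under the rotations `Rk`. -/
private theorem Rk_mem_capU_iff (k : ℕ) (p : EuclideanSpace ℝ (Fin 3)) :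
    Rk g k p ∈ capU ↔ p ∈ capU := by
  simp only [capU, mem_setOf_eq, norm_proj_Rk, Rk_apply_two]

/-- Beyond parameter `1/4` the valley arc stays outside the cap region: on the upper sheet its
planar radius is the parameter, on the lower sheet its height is `≤ 0`. -/
private theorem vArcFun_not_mem_capU (hg : 2 ≤ g) {s : ℝ} (hs : capR ≤ s) :
    vArcFun hg s ∉ capU := by
  rintro ⟨h1, h2⟩
  rcases le_or_gt s (rho4 hg) with h | h
  · rw [proj_vArcFun_of_le hg h, norm_pol, abs_of_nonneg (capR_pos.le.trans hs)] at h1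
    linarith
  · rw [vArcFun_apply_two_of_lt hg h] at h2
    linarith [vHt_nonneg (g := g) (2 * rho4 hg - s)]

/-- The truncated arcs avoid the cap region. -/
private theorem tArc_not_mem_capU (hg : 2 ≤ g) (k : ℕ) (t : I) : tArc hg k t ∉ capU := by
  rw [tArc_apply, tArcFun, Rk_mem_capU_iff]
  exact vArcFun_not_mem_capU hg (capR_le_param hg t)

/-! ## Helpers: the arcs lie in the capped slices -/

/-- The `k`-th truncated arc lies in the `k`-th capped slice. -/
private theorem tArc_mem_capS (hg : 2 ≤ g) (k : ℕ) (t : I) : tArc hg k t ∈ capS g k := by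
  obtain ⟨u, hu, -⟩ := exists_tArc_eq_arcK hg k t
  refine ⟨?_, tArc_not_mem_capU hg k t⟩
  rw [hu]
  exact range_arcK_subset hg k ⟨u, rfl⟩

/-- The `(k+1)`-st truncated arc lies in the `k`-th capped slice. -/
private theorem tArc_succ_mem_capS (hg : 2 ≤ g) (k : ℕ) (t : I) : tArc hg (k + 1) t ∈ capS g k := by
  obtain ⟨u, hu, -⟩ := exists_tArc_eq_arcK hg (k + 1) t
  refine ⟨?_, tArc_not_mem_capU hg (k + 1) t⟩
  rw [hu]
  exact range_arcK_succ_subset hg k ⟨u, rfl⟩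

/-- The cap-circle arc of the `k`-th slice lies in the `k`-th capped slice: before rotation it is
the upper sheet over `pol (1/4) θ`, `|θ| ≤ π/g` (in the wedge), of planar radius exactly `1/4`. -/
private theorem capArc_mem_capS (hg : 2 ≤ g) (k : ℕ) (t : I) : capArc hg k t ∈ capS g k := by
  have hg0 : (0 : ℝ) < g := by exact_mod_cast (show 0 < g by omega)
  have hg' : (2 : ℝ) ≤ g := by exact_mod_cast hg
  have hπg : π / g ≤ π / 2 := div_le_div_of_nonneg_left Real.pi_pos.le two_pos hg'
  have hup : (1 - 2 * (t : ℝ)) * π / g ≤ π / g := by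
    apply div_le_div_of_nonneg_right _ hg0.le
    nlinarith [Real.pi_pos, t.2.1]
  have hlo : -(π / g) ≤ (1 - 2 * (t : ℝ)) * π / g := by
    rw [← neg_div]
    apply div_le_div_of_nonneg_right _ hg0.le
    nlinarith [Real.pi_pos, t.2.2]
  have hq : flower g (pol capR ((1 - 2 * (t : ℝ)) * π / g)) ≤ level g :=
    (flower_pol_le_prof capR_pos.le _).trans
      (prof_lt_level_of_le hg capR_pos.le (by rw [capR_eq]; norm_num)).le
  have hmem : upperPt (flower g) (level g) (pol capR ((1 - 2 * (t : ℝ)) * π / g)) ∈ sectorZ g := by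
    refine ⟨upperPt_mem hq, ?_⟩
    rw [mem_preimage, proj_upperPt]
    refine ⟨hq, ?_⟩
    rw [arg_toC_pol capR_pos ⟨by linarith [Real.pi_pos], by linarith [Real.pi_pos]⟩]
    exact abs_le.2 ⟨hlo, hup⟩
  refine ⟨⟨_, hmem, rfl⟩, ?_⟩
  rw [capArc_apply, capArcFun, Rk_mem_capU_iff]
  rintro ⟨h1, -⟩
  rw [proj_upperPt, norm_pol, abs_of_pos capR_pos] at h1
  exact lt_irrefl _ h1

/-! ## Helpers: range, injectivity, incidence -/

/-- The truncated arc is the part of the melon arc outside the cap (the inclusion `⊇` is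
`range_arcK_diff_capU_subset_range_tArc` of the seams stub). -/
private theorem range_tArc (hg : 2 ≤ g) (k : ℕ) : range (tArc hg k) = range (arcK hg k) \ capU := by
  refine Subset.antisymm ?_ (range_arcK_diff_capU_subset_range_tArc hg k)
  rintro _ ⟨t, rfl⟩
  obtain ⟨u, hu, -⟩ := exists_tArc_eq_arcK hg k t
  exact ⟨⟨u, hu.symm⟩, tArc_not_mem_capU hg k t⟩

/-- The truncated arcs are injective. -/
private theorem injective_tArc (hg : 2 ≤ g) (k : ℕ) : Injective (tArc hg k) := by
  intro t t' h
  rw [tArc_apply, tArc_apply, tArcFun, tArcFun] at h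
  have h1 := injOn_vArcFun hg (param_mem_Icc hg t) (param_mem_Icc hg t') ((Rk g k).injective h)
  have hd := two_rho4_sub_capR_pos hg
  exact Subtype.ext (mul_right_cancel₀ hd.ne' (by linarith))

/-- The truncated arcs `tArc (n+1)` and `tArc 0` (`g = n + 2`) meet only at the lower pole. -/
private theorem tArc_meet {n : ℕ} (hg : 2 ≤ n + 2) (s t : I) (h : tArc hg (n + 1) s = tArc hg 0 t) :
    s = 0 ∧ t = 0 := by
  obtain ⟨u, hu, hu'⟩ := exists_tArc_eq_arcK hg (n + 1) s
  obtain ⟨v, hv, hv'⟩ := exists_tArc_eq_arcK hg 0 t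
  rw [hu, hv] at h
  have hd := two_rho4_sub_capR_pos hg
  have hcs := capR_le_param hg s
  rcases arcK_meet hg u v h with ⟨hu0, -⟩ | ⟨hu1, hv1⟩
  · -- parameter `0` of the melon arc is the upper pole, which is not on the truncated arc
    exfalso
    rw [hu0] at hu'
    simp only [Icc.coe_zero, mul_zero] at hu'
    linarith [capR_pos]
  · rw [hu1] at hu'
    rw [hv1] at hv'
    simp only [Icc.coe_one, mul_one] at hu' hv'
    have hs0 : (s : ℝ) * (2 * rho4 hg - capR) = 0 := by linarith
    have ht0 : (t : ℝ) * (2 * rho4 hg - capR) = 0 := by linarith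
    exact ⟨Subtype.ext ((mul_eq_zero.1 hs0).resolve_right hd.ne'),
      Subtype.ext ((mul_eq_zero.1 ht0).resolve_right hd.ne')⟩

/-! ## Helpers: simple connectivity of injective paths -/

/-- The range of an injective path of a Hausdorff space is simply connected (an embedded
interval). -/
private theorem isSimplyConnected_range_of_injective {X : Type*} [TopologicalSpace X] [T2Space X]
    {a b : X} (γ : Path a b) (hγ : Injective γ) : IsSimplyConnected (range γ) := by
  rw [← image_univ]
  have hce : Topology.IsClosedEmbedding γ := γ.continuous.isClosedEmbedding hγ
  rw [hce.isEmbedding.isSimplyConnected_image]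
  change SimplyConnectedSpace (univ : Set I)
  haveI : ContractibleSpace I :=
    (convex_Icc (0 : ℝ) 1).contractibleSpace ⟨0, left_mem_Icc.2 zero_le_one⟩
  haveI : SimplyConnectedSpace I := SimplyConnectedSpace.ofContractible I
  exact (Homeomorph.Set.univ I).toHomotopyEquiv.simplyConnectedSpace_iff.2 inferInstance

/-- A concatenation of two injective paths meeting only at the junction is injective. -/
private theorem injective_trans {X : Type*} [TopologicalSpace X] {a b c : X} (γ₁ : Path a b)
    (γ₂ : Path b c) (h₁ : Injective γ₁) (h₂ : Injective γ₂)
    (hmeet : ∀ s t, γ₁ s = γ₂ t → s = 1 ∧ t = 0) : Injective (γ₁.trans γ₂) := by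
  intro x y h
  rw [Path.trans_apply, Path.trans_apply] at h
  split_ifs at h with hx hy hy
  · have e := congrArg (fun u : I => (u : ℝ)) (h₁ h)
    simp only at e
    exact Subtype.ext (by linarith)
  · exfalso
    have e := congrArg (fun u : I => (u : ℝ)) (hmeet _ _ h).2
    simp only [Icc.coe_zero] at e
    exact hy (by linarith)
  · exfalso
    have e := congrArg (fun u : I => (u : ℝ)) (hmeet _ _ h.symm).2
    simp only [Icc.coe_zero] at e
    exact hx (by linarith)
  · have e := congrArg (fun u : I => (u : ℝ)) (h₂ h)
    simp only at e
    exact Subtype.ext (by linarith)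

/-- The `V` of the two truncated arcs `tArc (n+1)`, `tArc 0` (`g = n + 2`) is simply connected: it
is the range of the injective path `(tArc (n+1))⁻¹ · tArc 0`. -/
private theorem isSimplyConnected_union_range_tArc {n : ℕ} (hg : 2 ≤ n + 2) :
    IsSimplyConnected (range (tArc hg (n + 1)) ∪ range (tArc hg 0)) := by
  have hinj : Injective ((tArc hg (n + 1)).symm.trans (tArc hg 0)) := by
    refine injective_trans _ _ ?_ (injective_tArc hg 0) ?_
    · intro x y h
      rw [Path.symm_apply, Path.symm_apply] at h
      exact unitInterval.symm_bijective.injective (injective_tArc hg (n + 1) h)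
    · intro x y h
      rw [Path.symm_apply] at h
      obtain ⟨h1, h2⟩ := tArc_meet hg _ _ h
      exact ⟨unitInterval.symm_eq_zero.1 h1, h2⟩
  have key := isSimplyConnected_range_of_injective _ hinj
  rwa [Path.trans_range, Path.symm_range] at key

/-! ## The stub -/

/-- **Cap basics, arcs** (registered stub `stub_capArcs`): the truncated arcs and the cap-circle
arcs lie in the capped slices (`tArc k`, `tArc (k+1)`, `capArc k` in `capS k`), the truncated arc
is the part of the melon arc outside the cap, it is injective, the truncated arcs `tArc (n+1)`,
`tArc 0` (`g = n + 2`) meet only in the lower pole, and an injective arc resp. the `V` of two such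
arcs is simply connected. -/
theorem stub_capArcs : ∀ {n : ℕ} (hg : 2 ≤ n + 2) (k : ℕ), (∀ t : I, tArc hg k t ∈ capS (n + 2) k) ∧ (∀ t : I, tArc hg (k + 1) t ∈ capS (n + 2) k) ∧ (∀ t : I, capArc hg k t ∈ capS (n + 2) k) ∧ range (tArc hg k) = range (arcK hg k) \ capU ∧ Injective (tArc hg k) ∧ (∀ s t : I, tArc hg (n + 1) s = tArc hg 0 t → s = 0 ∧ t = 0) ∧ IsSimplyConnected (range (tArc hg k)) ∧ IsSimplyConnected (range (tArc hg (n + 1)) ∪ range (tArc hg 0)) := by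
  intro n hg k
  exact ⟨tArc_mem_capS hg k, tArc_succ_mem_capS hg k, capArc_mem_capS hg k, range_tArc hg k,
    injective_tArc hg k, tArc_meet hg, isSimplyConnected_range_of_injective _ (injective_tArc hg k),
    isSimplyConnected_union_range_tArc hg⟩

end FlowerCap

end Summit.SmoothPoincare4.SmoothPoincare4.Cruxes.AgkCor6Sufficiency.LpBySphereSystemSurgery

end
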